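import Mathlib
import Literature.NumberTheory.LFunctions.Zhang2022.Section16BLocRatio
import Literature.NumberTheory.LFunctions.Zhang2022.TypedSection15B
import HarnessLib

/-!
# Zhang (2022) §16 p. 93, u034 in the local reading: `ϖ₂ⱼ^loc(m) = χ(m)ϱ*ⱼ(m) + O(τ₂(m)D^{−3})` for
# `𝔮`-rough `m < P` — `Typed.Section16B.Step16_u034L` HOLDS

Topic `Literature/NumberTheory/LFunctions/Zhang2022` (Landau–Siegel audit tree; verdict-neutral).
Y. Zhang, *Discrete mean estimates and the Landau–Siegel zero*, arXiv:2211.02515v1 (2022)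
[Zhang2022LandauSiegel] — **an unrefereed manuscript under adjudication**; this file PROVES a typed
claim node of the campaign about the manuscript's own objects and asserts nothing about its Theorems 1–2.
ZHANG-L WP16 (seat zl-w16-p8), Block A of leaf h16_16 (binder of record `Eq16_16R2`), DAG node
`Z22:§16.u034` [Z22 p. 93, tex L4615] in the local reading of record F16B-1
(`Typed.Section16B.Step16_u034L`, file `TypedSection16BLocal`): "for `(m,𝔮) = 1` and `m < P` we have
trivially `ϖ₂ⱼ(m) = χ(m)ϱ*ⱼ(m) + O(τ₂(m)D^{−c})`" with `ϖ₂ⱼ ↦ ϖ₂ⱼ^loc = varpi2loc`.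

Proof (the §15 twin is the tree's `Typed.Section15B.eq15_21_of_step15_u040`): for `χ` real and
`(m,D) = 1`, `χ(m)ϱ*ⱼ(m) = Σ_{m=dl} d^{βⱼ}χ(l)` (`Typed.Section15B.chi_mul_varrhoStar_eq`), so
`ϖ₂ⱼ^loc(m) − χ(m)ϱ*ⱼ(m) = Σ_{m=dl} d^{βⱼ}χ(l)·(λ₂(d)∏_{q∣m}F_q(d,l)/F_q(1,1) − 1)`; and
`λ₂(d)∏_{q∣m}F_q(d,l)/F_q(1,1) = ∏_{q∣m} Λ_q(d)F_q(d,l)/F_q(1,1)` is a product over the `ω(m)` primes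
of `m`, all `≥ D⁴`, of factors within `100/q ≤ 100/D⁴` of `1`
(`Section16BLocRatio.norm_lamFlag_mul_locRatio_sub_one_le`), hence within `e^{100ω(m)/D⁴} − 1 ≤ 200ω(m)/D⁴`
of `1`; with `ω(m) ≤ log₂ m ≤ 2𝓛⁹` (`m < P = e^{𝓛⁹}`) and `400𝓛⁹ ≤ D` for large `D` this is `≤ D^{−3}`
per divisor pair, `τ₂(m)` pairs. Constants of the closer: `c = 3`, `C = 1`.

Also proved, for the other Block-A steps: `norm_lam2_mul_prod_locRatio_sub_one_le` (the per-pair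
bound at every prime floor `Q ≥ 23`) and `norm_varpi2loc_le` (`‖ϖ₂ⱼ^loc(m)‖ ≤ 2τ₂(m)` for rough
`m < P`, all large `D`).

## References
* Y. Zhang, arXiv:2211.02515v1 (2022), §16 p. 93 (u034); §15 (15.21) p. 86.
  [cite: Zhang2022LandauSiegel, §16 p. 93 (u034)]
-/

noncomputable section

open Complex Real Finset Filter Topology

namespace Literature.NumberTheory.LFunctions.Zhang2022.Typed.Section16B

open Literature.NumberTheory.LFunctions.Zhang2022
open Literature.NumberTheory.LFunctions.Zhang2022.Skeleton
open Literature.NumberTheory.LFunctions.Zhang2022.Typed.Section16A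

variable (c' : ℝ) {D : ℕ} (χ : DirichletCharacter ℂ D)

/-! ## §1. `λ₂(d)·∏_{q∣m} locRatio = ∏_{q∣m} Λ_q(d)·locRatio` and its distance from `1` -/

/-- `λ₂(d,1) = ∏_{q ∈ m.primeFactors} (λ₂(q) if q ∣ d, else 1)` for `d ∣ m`, `m ≠ 0` (the product
(16.u014) defining `λ₂` runs over the prime factors of `d`, a subset of those of `m`).
[cite: Zhang2022LandauSiegel, §16 p. 90 (u014)] -/
theorem lam2_eq_prod_ite {m d : ℕ} (hm : m ≠ 0) (hd : d ∣ m) :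
    lam2 c' χ d 1 = ∏ q ∈ m.primeFactors, (if q ∣ d then lam2 c' χ q 1 else 1) := by
  have hd0 : d ≠ 0 := fun h => hm (by rw [h] at hd; exact zero_dvd_iff.mp hd)
  rw [Finset.prod_ite, Finset.prod_const_one, mul_one]
  have hfilt : m.primeFactors.filter (fun q => q ∣ d) = d.primeFactors := by
    ext q
    simp only [Finset.mem_filter, Nat.mem_primeFactors]
    constructor
    · rintro ⟨⟨hq, -, -⟩, hqd⟩; exact ⟨hq, hqd, hd0⟩
    · rintro ⟨hq, hqd, -⟩; exact ⟨⟨hq, hqd.trans hd, hm⟩, hqd⟩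
  rw [hfilt]
  unfold lam2
  refine Finset.prod_congr rfl fun q hq => ?_
  rw [(Nat.prime_of_mem_primeFactors hq).primeFactors, Finset.prod_singleton]

/-- **The per-divisor-pair bound**: if `m ≠ 0` has all its prime factors `≥ Q` with `Q ≥ 23`, then for
every divisor pair `(d,l)` of `m` and every `j`,
`‖λ₂(d)·∏_{q∣m} locRatio(q;d,l;1−βⱼ) − 1‖ ≤ exp(100·ω(m)/Q) − 1` — the product of the `ω(m)` twisted
local ratios, each within `100/q ≤ 100/Q` of `1` (`norm_lamFlag_mul_locRatio_sub_one_le`).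
[cite: Zhang2022LandauSiegel, §16 p. 93 (u034)] -/
theorem norm_lam2_mul_prod_locRatio_sub_one_le {m : ℕ} (hm : m ≠ 0) {Q : ℕ} (hQ : 23 ≤ Q)
    (hmin : ∀ q ∈ m.primeFactors, Q ≤ q) {x : ℕ × ℕ} (hx : x ∈ m.divisorsAntidiagonal) (j : ℕ) :
    ‖lam2 c' χ x.1 1 * ∏ q ∈ m.primeFactors, locRatio c' χ q x.1 x.2 (1 - betaJ c' D j) - 1‖ ≤
      Real.exp (100 * m.primeFactors.card / Q) - 1 := by
  have hd : x.1 ∣ m := Dvd.intro x.2 (Nat.mem_divisorsAntidiagonal.mp hx).1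
  rw [lam2_eq_prod_ite c' χ hm hd, ← Finset.prod_mul_distrib]
  set g : ℕ → ℂ := fun q =>
    (if q ∣ x.1 then lam2 c' χ q 1 else 1) * locRatio c' χ q x.1 x.2 (1 - betaJ c' D j) - 1 with hg
  have hfg : ∀ q, (if q ∣ x.1 then lam2 c' χ q 1 else 1) * locRatio c' χ q x.1 x.2 (1 - betaJ c' D j) =
      1 + g q := fun q => by rw [hg]; ring
  simp_rw [hfg]
  refine (Finset.norm_prod_one_add_sub_one_le _ _).trans ?_
  gcongr
  have hQ0 : (0 : ℝ) < Q := by exact_mod_cast (show 0 < Q by omega)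
  calc ∑ q ∈ m.primeFactors, ‖g q‖ ≤ ∑ q ∈ m.primeFactors, (100 : ℝ) / Q := by
        refine Finset.sum_le_sum fun q hq => ?_
        have hqp := Nat.prime_of_mem_primeFactors hq
        have hqQ := hmin q hq
        have h := norm_lamFlag_mul_locRatio_sub_one_le c' χ hqp (hQ.trans hqQ) x.1 x.2 j
        rw [hg]; dsimp only
        refine h.trans ?_
        exact div_le_div_of_nonneg_left (by norm_num) hQ0 (by exact_mod_cast hqQ)
    _ = 100 * m.primeFactors.card / Q := by
        rw [Finset.sum_const, nsmul_eq_mul]; ring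

/-- `ω(m) ≤ log m / log 2` (`2^{ω(m)} ≤ ∏_{q∣m} q ≤ m`). [folklore] -/
private theorem card_primeFactors_le_log {m : ℕ} (hm : m ≠ 0) :
    (m.primeFactors.card : ℝ) ≤ Real.log m / Real.log 2 := by
  have h2 : 2 ^ m.primeFactors.card ≤ m := by
    calc 2 ^ m.primeFactors.card ≤ ∏ q ∈ m.primeFactors, q :=
          Finset.pow_card_le_prod _ _ _ fun q hq => (Nat.prime_of_mem_primeFactors hq).two_le
      _ ≤ m := Nat.le_of_dvd (Nat.pos_of_ne_zero hm) (Nat.prod_primeFactors_dvd m)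
  have h2' : (2 : ℝ) ^ m.primeFactors.card ≤ m := by exact_mod_cast h2
  have hlog := Real.log_le_log (by positivity) h2'
  rw [Real.log_pow] at hlog
  rw [le_div_iff₀ (Real.log_pos one_lt_two)]
  linarith

/-- Any real threshold on `𝓛 = log D` holds for all large `D`. [cite: Zhang2022LandauSiegel, §2 (2.1)] -/
private theorem exists_forall_le_ell_u034 (M : ℝ) : ∃ D₀ : ℕ, ∀ D : ℕ, D₀ ≤ D → M ≤ ell D := by
  refine ⟨⌈Real.exp M⌉₊ + 1, fun D hD => ?_⟩
  have hD1 : (⌈Real.exp M⌉₊ : ℝ) + 1 ≤ D := by exact_mod_cast hD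
  have hD0 : (0 : ℝ) < D := by linarith [Nat.le_ceil (Real.exp M), Real.exp_pos M]
  rw [ell, Real.le_log_iff_exp_le hD0]
  linarith [Nat.le_ceil (Real.exp M)]

/-- `400·𝓛⁹ ≤ D` once `𝓛 ≥ 400·10!` (`𝓛¹⁰/10! ≤ e^{𝓛} = D`). [folklore] -/
private theorem ell_pow_nine_le {D : ℕ} (hℓ : (400 * Nat.factorial 10 : ℝ) ≤ ell D) :
    400 * ell D ^ 9 ≤ (D : ℝ) := by
  have hℓ0 : 0 < ell D := lt_of_lt_of_le (by positivity) hℓ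
  have hD0 : (0 : ℝ) < D := by
    by_contra h
    push Not at h
    have : (D : ℝ) = 0 := le_antisymm h (Nat.cast_nonneg D)
    rw [ell, this, Real.log_zero] at hℓ0
    exact lt_irrefl _ hℓ0
  have h10 := Real.pow_div_factorial_le_exp (ell D) hℓ0.le 10
  rw [ell, Real.exp_log hD0] at h10
  rw [← ell] at h10
  have hfac : (0 : ℝ) < Nat.factorial 10 := by positivity
  rw [div_le_iff₀ hfac] at h10
  -- `400 ℓ⁹ · (400·10!) ≤ 400 ℓ⁹ · ℓ = 400 ℓ¹⁰ ≤ 400 · 10! · D`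
  have h9 : 0 ≤ ell D ^ 9 := by positivity
  nlinarith [mul_le_mul_of_nonneg_left hℓ h9]

/-! ## §2. `Step16_u034L` holds -/

/-- **u034 in the local reading, explicit form**: there is `D₀` such that for all `D ≥ D₀`, every
quadratic `χ (mod D)` (primitivity and Assumption (A) are not used), every `j`, and every `𝔮`-rough
`1 ≤ m < P`, `‖ϖ₂ⱼ^loc(m) − χ(m)ϱ*ⱼ(m)‖ ≤ τ₂(m)·D^{−3}`. [cite: Zhang2022LandauSiegel, §16 p. 93 (u034)] -/
theorem norm_varpi2loc_sub_main_le : ∃ D₀ : ℕ, ∀ (D : ℕ) [NeZero D] (χ : DirichletCharacter ℂ D),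
    D₀ ≤ D → χ.IsQuadratic → ∀ j m : ℕ, 1 ≤ m → Nat.Coprime m (frakq D) → (m : ℝ) < bigP D →
      ‖varpi2loc c' χ j m - χ (m : ZMod D) * varrhoStar c' χ j m‖ ≤
        m.divisors.card * (D : ℝ) ^ (-(3 : ℝ)) := by
  obtain ⟨D₁, hD₁⟩ := exists_forall_le_ell_u034 (400 * Nat.factorial 10)
  refine ⟨max D₁ 3, fun D _ χ hD hq j m hm hmq hmP => ?_⟩
  have hDℓ : (400 * Nat.factorial 10 : ℝ) ≤ ell D := hD₁ D (le_trans (le_max_left _ _) hD)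
  have hD3 : 3 ≤ D := le_trans (le_max_right _ _) hD
  have hD2 : 2 ≤ D := by omega
  have hDpos : (0 : ℝ) < D := by exact_mod_cast (show 0 < D by omega)
  have hm0 : m ≠ 0 := by omega
  have hmD : Nat.Coprime m D := Typed.Section15B.coprime_of_coprime_frakq hD2 hmq
  -- the floor `Q = D⁴ ≥ 81 ≥ 23` on the prime factors of `m`
  have hQ : 23 ≤ D ^ 4 := le_trans (by norm_num) (Nat.pow_le_pow_left hD3 4)
  have hmin : ∀ q ∈ m.primeFactors, D ^ 4 ≤ q := fun q hq =>
    pow_four_le_of_mem_primeFactors_of_coprime_frakq' hmq hq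
  -- the per-pair bound `ε`
  set ε : ℝ := Real.exp (100 * m.primeFactors.card / (D ^ 4 : ℕ)) - 1 with hε
  have hpair : ∀ x ∈ m.divisorsAntidiagonal,
      ‖lam2 c' χ x.1 1 * ∏ q ∈ m.primeFactors, locRatio c' χ q x.1 x.2 (1 - betaJ c' D j) - 1‖ ≤ ε :=
    fun x hx => norm_lam2_mul_prod_locRatio_sub_one_le c' χ hm0 hQ hmin hx j
  -- `ε ≤ D^{−3}`: `ω(m) ≤ 2𝓛⁹`, `100·2𝓛⁹/D⁴ ≤ 1`, `e^y − 1 ≤ 2y`, `400𝓛⁹ ≤ D`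
  have hω : (m.primeFactors.card : ℝ) ≤ 2 * ell D ^ 9 := by
    have h1 := card_primeFactors_le_log hm0
    have hlogm : Real.log m < ell D ^ 9 := by
      have hm1 : (0 : ℝ) < m := by exact_mod_cast Nat.pos_of_ne_zero hm0
      have := Real.log_lt_log hm1 hmP
      rwa [bigP, Real.log_exp] at this
    have hlog2 : (1 : ℝ) / 2 ≤ Real.log 2 := by
      have := Real.log_two_gt_d9; linarith
    calc (m.primeFactors.card : ℝ) ≤ Real.log m / Real.log 2 := h1
      _ ≤ Real.log m / (1 / 2) :=
          div_le_div_of_nonneg_left (Real.log_natCast_nonneg m) (by norm_num) hlog2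
      _ ≤ 2 * ell D ^ 9 := by linarith
  have hD4 : ((D ^ 4 : ℕ) : ℝ) = (D : ℝ) ^ 4 := by push_cast; ring
  have hmain := ell_pow_nine_le hDℓ
  have hy : 100 * (m.primeFactors.card : ℝ) / (D ^ 4 : ℕ) ≤ 200 * ell D ^ 9 / (D : ℝ) ^ 4 := by
    rw [hD4, div_le_div_iff_of_pos_right (by positivity)]
    linarith
  have hy0 : 0 ≤ 100 * (m.primeFactors.card : ℝ) / (D ^ 4 : ℕ) := by positivity
  have hy1 : 200 * ell D ^ 9 / (D : ℝ) ^ 4 ≤ 1 := by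
    rw [div_le_one (by positivity)]
    have hD1 : (1 : ℝ) ≤ D := by exact_mod_cast (show 1 ≤ D by omega)
    have : (D : ℝ) ≤ (D : ℝ) ^ 4 := le_self_pow₀ hD1 (by norm_num)
    have h9 : 0 ≤ ell D ^ 9 := by
      have : (0 : ℝ) ≤ ell D := le_trans (by positivity) hDℓ
      positivity
    linarith
  have hεle : ε ≤ 2 * (200 * ell D ^ 9 / (D : ℝ) ^ 4) := by
    have habs : |100 * (m.primeFactors.card : ℝ) / (D ^ 4 : ℕ)| ≤ 1 := by
      rw [abs_of_nonneg hy0]; exact hy.trans hy1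
    have h := Real.abs_exp_sub_one_le habs
    rw [abs_of_nonneg hy0] at h
    have h' := (le_abs_self _).trans h
    rw [hε]
    linarith
  have hD3pow : 2 * (200 * ell D ^ 9 / (D : ℝ) ^ 4) ≤ (D : ℝ) ^ (-(3 : ℝ)) := by
    rw [show (-(3 : ℝ)) = -((3 : ℕ) : ℝ) by norm_num, Real.rpow_neg hDpos.le, Real.rpow_natCast]
    rw [show 2 * (200 * ell D ^ 9 / (D : ℝ) ^ 4) = 400 * ell D ^ 9 / (D : ℝ) ^ 4 by ring,
      div_le_iff₀ (by positivity)]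
    calc 400 * ell D ^ 9 ≤ (D : ℝ) := hmain
      _ = ((D : ℝ) ^ 3)⁻¹ * (D : ℝ) ^ 4 := by field_simp
  -- expand both sides over the divisor pairs of `m`
  have hmain_eq : varpi2loc c' χ j m - χ (m : ZMod D) * varrhoStar c' χ j m =
      ∑ x ∈ m.divisorsAntidiagonal, ((x.1 : ℂ) ^ betaJ c' D j * χ (x.2 : ZMod D)) *
        (lam2 c' χ x.1 1 * ∏ q ∈ m.primeFactors, locRatio c' χ q x.1 x.2 (1 - betaJ c' D j) - 1) := by
    rw [Typed.Section15B.chi_mul_varrhoStar_eq c' χ hq j hmD, varpi2loc, ← Finset.sum_sub_distrib]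
    refine Finset.sum_congr rfl fun x _ => ?_
    ring
  rw [hmain_eq]
  -- count the pairs
  have hcard : (m.divisorsAntidiagonal.card : ℝ) = m.divisors.card := by
    rw [← Nat.map_div_right_divisors, Finset.card_map]
  have hε0 : 0 ≤ ε := by rw [hε]; linarith [Real.add_one_le_exp (100 * (m.primeFactors.card : ℝ) / (D ^ 4 : ℕ))]
  calc ‖∑ x ∈ m.divisorsAntidiagonal, ((x.1 : ℂ) ^ betaJ c' D j * χ (x.2 : ZMod D)) *
        (lam2 c' χ x.1 1 * ∏ q ∈ m.primeFactors, locRatio c' χ q x.1 x.2 (1 - betaJ c' D j) - 1)‖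
      ≤ ∑ x ∈ m.divisorsAntidiagonal, ‖((x.1 : ℂ) ^ betaJ c' D j * χ (x.2 : ZMod D)) *
        (lam2 c' χ x.1 1 * ∏ q ∈ m.primeFactors, locRatio c' χ q x.1 x.2 (1 - betaJ c' D j) - 1)‖ :=
        norm_sum_le _ _
    _ ≤ ∑ _x ∈ m.divisorsAntidiagonal, ε := by
        refine Finset.sum_le_sum fun x hx => ?_
        obtain ⟨hx1, -⟩ := Nat.mem_divisorsAntidiagonal.mp hx
        have hx1pos : 1 ≤ x.1 := Nat.one_le_iff_ne_zero.mpr fun h => hm0 (by rw [← hx1, h, zero_mul])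
        rw [norm_mul, norm_mul, Typed.Section15B.norm_natCast_cpow_betaJ c' D j hx1pos, one_mul]
        calc ‖χ (x.2 : ZMod D)‖ * ‖lam2 c' χ x.1 1 *
              ∏ q ∈ m.primeFactors, locRatio c' χ q x.1 x.2 (1 - betaJ c' D j) - 1‖
            ≤ 1 * ε :=
              mul_le_mul (DirichletCharacter.norm_le_one χ _) (hpair x hx) (norm_nonneg _) zero_le_one
          _ = ε := one_mul ε
    _ = m.divisors.card * ε := by rw [Finset.sum_const, nsmul_eq_mul, hcard]
    _ ≤ m.divisors.card * (D : ℝ) ^ (-(3 : ℝ)) := by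
        gcongr
        exact hεle.trans hD3pow

/-- **u034 in the local reading HOLDS** (`Typed.Section16B.Step16_u034L`, F16B-1), with `c = 3`,
`C = 1`: for all large `D`, every real primitive `χ (mod D)` (Assumption (A) is not used), `j ∈ {1,2}`,
and every `𝔮`-rough `1 ≤ m < P`, `‖ϖ₂ⱼ^loc(m) − χ(m)ϱ*ⱼ(m)‖ ≤ τ₂(m)·D^{−3}`.
[cite: Zhang2022LandauSiegel, §16 p. 93 (u034)] -/
theorem step16_u034L_holds : Step16_u034L c' := by
  obtain ⟨D₀, h⟩ := norm_varpi2loc_sub_main_le c'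
  refine ⟨3, by norm_num, 1, D₀, fun D _ χ hD hq _ _ j _ m hm hmq hmP => ?_⟩
  rw [one_mul]
  exact h D χ hD hq j m hm hmq hmP

/-- `Step16_u034L` — `_holds` alias of `step16_u034L_holds` above under the fact's exact name (appended
2026-08-28, D-0026 bookkeeping: the proof term is the existing theorem of this file; no statement,
definition or attribute is edited; no new named fact; the ledger's debt table listed the fact
unproved). [cite: Zhang2022LandauSiegel, §16 p. 93 (u034)] -/
theorem _root_.Literature.NumberTheory.LFunctions.Zhang2022.Typed.Section16B.Step16_u034L_holds :
    Step16_u034L c' :=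
  _root_.Literature.NumberTheory.LFunctions.Zhang2022.Typed.Section16B.step16_u034L_holds (c' := c')

/-! ## §3. A majorant: `‖ϖ₂ⱼ^loc(m)‖ ≤ 2τ₂(m)` for rough `m < P` -/

/-- `‖ϱ*ⱼ(m)‖ ≤ τ₂(m)` (`|d^{βⱼ}χ(d)| ≤ 1` for each of the `τ₂(m)` divisors).
[cite: Zhang2022LandauSiegel, §15 (15.21) p. 86] -/
theorem norm_varrhoStar_le_card_divisors (j : ℕ) (m : ℕ) :
    ‖varrhoStar c' χ j m‖ ≤ m.divisors.card := by
  unfold varrhoStar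
  calc ‖∑ d ∈ m.divisors, (d : ℂ) ^ betaJ c' D j * χ (d : ZMod D)‖
      ≤ ∑ d ∈ m.divisors, ‖(d : ℂ) ^ betaJ c' D j * χ (d : ZMod D)‖ := norm_sum_le _ _
    _ ≤ ∑ _d ∈ m.divisors, (1 : ℝ) := by
        refine Finset.sum_le_sum fun d hd => ?_
        have hd1 : 1 ≤ d := Nat.pos_of_mem_divisors hd
        rw [norm_mul, Typed.Section15B.norm_natCast_cpow_betaJ c' D j hd1, one_mul]
        exact DirichletCharacter.norm_le_one χ _
    _ = m.divisors.card := by rw [Finset.sum_const, nsmul_eq_mul, mul_one]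

/-- **`‖ϖ₂ⱼ^loc(m)‖ ≤ 2τ₂(m)` for `𝔮`-rough `1 ≤ m < P`**, for all large `D` and every quadratic `χ`
(from the explicit u034: `‖χ(m)ϱ*ⱼ(m)‖ ≤ τ₂(m)` and `τ₂(m)D^{−3} ≤ τ₂(m)`).
[cite: Zhang2022LandauSiegel, §16 p. 93 (u034)] -/
theorem norm_varpi2loc_le : ∃ D₀ : ℕ, ∀ (D : ℕ) [NeZero D] (χ : DirichletCharacter ℂ D),
    D₀ ≤ D → χ.IsQuadratic → ∀ j m : ℕ, 1 ≤ m → Nat.Coprime m (frakq D) → (m : ℝ) < bigP D →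
      ‖varpi2loc c' χ j m‖ ≤ 2 * m.divisors.card := by
  obtain ⟨D₀, h⟩ := norm_varpi2loc_sub_main_le c'
  refine ⟨max D₀ 1, fun D _ χ hD hq j m hm hmq hmP => ?_⟩
  have hD₀ : D₀ ≤ D := le_trans (le_max_left _ _) hD
  have hD1 : (1 : ℝ) ≤ D := by exact_mod_cast le_trans (le_max_right _ _) hD
  have key := h D χ hD₀ hq j m hm hmq hmP
  have hmain : ‖χ (m : ZMod D) * varrhoStar c' χ j m‖ ≤ m.divisors.card := by
    rw [norm_mul]
    calc ‖χ (m : ZMod D)‖ * ‖varrhoStar c' χ j m‖ ≤ 1 * m.divisors.card :=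
          mul_le_mul (DirichletCharacter.norm_le_one χ _) (norm_varrhoStar_le_card_divisors c' χ j m)
            (norm_nonneg _) zero_le_one
      _ = m.divisors.card := one_mul _
  have hpow : (D : ℝ) ^ (-(3 : ℝ)) ≤ 1 := Real.rpow_le_one_of_one_le_of_nonpos hD1 (by norm_num)
  have hτ : (0 : ℝ) ≤ m.divisors.card := Nat.cast_nonneg _
  calc ‖varpi2loc c' χ j m‖
      = ‖(varpi2loc c' χ j m - χ (m : ZMod D) * varrhoStar c' χ j m) +
          χ (m : ZMod D) * varrhoStar c' χ j m‖ := by rw [sub_add_cancel]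
    _ ≤ ‖varpi2loc c' χ j m - χ (m : ZMod D) * varrhoStar c' χ j m‖ +
          ‖χ (m : ZMod D) * varrhoStar c' χ j m‖ := norm_add_le _ _
    _ ≤ m.divisors.card * (D : ℝ) ^ (-(3 : ℝ)) + m.divisors.card := add_le_add key hmain
    _ ≤ m.divisors.card * 1 + m.divisors.card := by gcongr
    _ = 2 * m.divisors.card := by ring

end Literature.NumberTheory.LFunctions.Zhang2022.Typed.Section16B
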